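import Summits.RiemannHypothesis.RiemannHypothesis.Theorems.JensenPolynomialsCapTailTable
import Summits.RiemannHypothesis.RiemannHypothesis.Theorems.JensenPolynomialsCapCertRows

/-!
# Route `JensenPolynomials` — uniform tail of `XiCumulantMajorantCap(Far)`, part T4: row weights, assembly, soundness

The uniform tail (all `d ≥ D⋆ = 100` at once; see part T1 `JensenPolynomialsCapTailCompute` for the scheme and the
certificate `tailCheck`) of the crux children `XiCumulantMajorantCap` (stmt-RiemannHypothesis-19217) and
`XiCumulantMajorantCapFar` (stmt-RiemannHypothesis-19472) of route `JensenPolynomials` (rung J-P(P1′), cell rh-jensen,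
engine seat g4).  RH-FREE, γ-FREE: elementary arithmetic on a fixed majorant series — nothing here is a statement about `ξ`
or `ζ`, and nothing here bears on the truth of RH.  Every lemma is stated over VARIABLE data `(q, D, y, bts, T, C, J, …)` and is
instantiated at the certificate's constants only by `exact` in part T4 (no tactic ever unfolds a `2⁹⁶`-scale constant).

This part: the `d`-uniform scaled row weights — `W₁(j) ≤ wOf D j/ONE` for all `d ≥ D ≥ 9` (rows `0, 1, √((4d−2)/d) ≤ 2, 3,
(4d+10)/d, (5d²+30d+8)/d²`, window `(6/5)(j−1)P_j`, energy `√(dP_j) ≤ √d < √(4(j−2)³)` since an energy row at `j ≥ 7` MEANS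
`d < 4(j−2)³`) and `W₁(j) ≤ 2^j` (`j ≥ 7`, via `n³ ≤ 4^{n+1}`), `g ≤ 1`; the assembly `tail_sound_of` (head `j ≤ J` against
the table, tails by the geometric envelope: `C·2^{−J}` and `C·4^{−J}/3`); and the instantiation
**`tailCheck_sound : tailCheck = true → ∀ d ≥ Dstar, both majorant sums (pin 10⁴, cap sequence verbatim) < 1`.**
-/

-- D-0017: `Summit.RiemannHypothesis.RiemannHypothesis.…` duplicates the namespace BY DESIGN (single-problem summit).
set_option linter.dupNamespace false

open Finset

namespace Summit.RiemannHypothesis.RiemannHypothesis.Theorems.JensenPolynomials.CapCert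

noncomputable section

open Real
open Summit.RiemannHypothesis.RiemannHypothesis.Theorems.JensenPolynomials

/-! ## Uniform row weights -/

/-- `n³ ≤ 4^{n+1}` for every `n`. -/
theorem cube_le_four_pow (n : ℕ) : n ^ 3 ≤ 4 ^ (n + 1) := by
  induction n with
  | zero => norm_num
  | succ n ih =>
    rcases Nat.lt_or_ge n 3 with h | h
    · interval_cases n <;> norm_num
    · have h1 : (n + 1) ^ 3 ≤ 4 * n ^ 3 := by
        have h34 : 3 * (n + 1) ≤ 4 * n := by omega
        have hp := Nat.pow_le_pow_left h34 3
        have h27 : 27 * (n + 1) ^ 3 ≤ 27 * (4 * n ^ 3) :=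
          calc 27 * (n + 1) ^ 3 = (3 * (n + 1)) ^ 3 := by ring
            _ ≤ (4 * n) ^ 3 := hp
            _ = 64 * n ^ 3 := by ring
            _ ≤ 108 * n ^ 3 := Nat.mul_le_mul_right _ (by norm_num)
            _ = 27 * (4 * n ^ 3) := by ring
        exact Nat.le_of_mul_le_mul_left h27 (by norm_num)
      calc (n + 1) ^ 3 ≤ 4 * n ^ 3 := h1
        _ ≤ 4 * 4 ^ (n + 1) := Nat.mul_le_mul_left 4 ih
        _ = 4 ^ (n + 1 + 1) := by rw [pow_succ 4 (n + 1)]; ring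

/-- **Every row `j ≥ 7` satisfies `W₁(j) ≤ 2^j`** (`d ≥ 9`; window: `(6/5)(j−1)P_j ≤ 2^j`; energy:
`√(dP_j) ≤ √d < √(4(j−2)³) ≤ 2^j`). -/
theorem W1r_le_two_pow {d : ℕ} (hd : 9 ≤ d) {j : ℕ} (hj : 7 ≤ j) (hjd : j ≤ d) : W1r d j ≤ (2 : ℝ) ^ j := by
  have hd3 : 3 ≤ d := by omega
  have hd0 : 0 < d := by omega
  have hP := (Pr_facts hd0 j).2
  have hP0 := (Pr_facts hd0 j).1
  unfold W1r rhoWinMin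
  rw [if_neg (by omega : ¬ j ≤ 4), if_neg (by omega : ¬ (j = 5 ∧ 8 ≤ d)), if_neg (by omega : ¬ (j = 6 ∧ 9 ≤ d))]
  by_cases hw : 4 * (j - 2) ^ 3 ≤ d
  · rw [if_pos hw, window_eq d j hd3]
    have hjR : (0 : ℝ) ≤ (j : ℝ) - 1 := by
      have : (1 : ℝ) ≤ j := by exact_mod_cast (show 1 ≤ j by omega)
      linarith
    have h2 : ((j : ℝ) - 1) ≤ (2 : ℝ) ^ (j - 1) := by
      have h' : ((j - 1 : ℕ) : ℝ) ≤ ((2 ^ (j - 1) : ℕ) : ℝ) := by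
        exact_mod_cast (Nat.lt_two_pow_self (n := j - 1)).le
      push_cast [Nat.cast_sub (show 1 ≤ j by omega)] at h'
      exact h'
    have h3 : (2 : ℝ) ^ j = 2 * 2 ^ (j - 1) := by
      conv_lhs => rw [show j = (j - 1) + 1 from by omega]
      rw [pow_succ]; ring
    have hp : (0 : ℝ) < 2 ^ (j - 1) := pow_pos (by norm_num) _
    rw [h3]
    calc 6 / 5 * ((j : ℝ) - 1) * Pr d j ≤ 6 / 5 * ((j : ℝ) - 1) * 1 :=
          mul_le_mul_of_nonneg_left hP (by positivity)
      _ ≤ 6 / 5 * (2 : ℝ) ^ (j - 1) := by nlinarith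
      _ ≤ 2 * 2 ^ (j - 1) := by nlinarith
  · rw [if_neg hw, energy_eq hd3 (by omega) hjd]
    have hdlt : d < 4 * (j - 2) ^ 3 := by omega
    have hc := cube_le_four_pow (j - 2)
    have h4 : 4 * (j - 2) ^ 3 ≤ 4 ^ j := by
      calc 4 * (j - 2) ^ 3 ≤ 4 * 4 ^ (j - 2 + 1) := Nat.mul_le_mul_left 4 hc
        _ = 4 ^ (j - 2 + 1 + 1) := by rw [pow_succ 4 (j - 2 + 1)]; ring
        _ = 4 ^ j := by congr 1; omega
    have hdR : (d : ℝ) ≤ (4 : ℝ) ^ j := by exact_mod_cast (hdlt.le.trans h4)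
    have hdP : (d : ℝ) * Pr d j ≤ (4 : ℝ) ^ j := by nlinarith [Nat.cast_nonneg (α := ℝ) d]
    calc √((d : ℝ) * Pr d j) ≤ √((4 : ℝ) ^ j) := Real.sqrt_le_sqrt hdP
      _ = (2 : ℝ) ^ j := by
          rw [show (4 : ℝ) ^ j = ((2 : ℝ) ^ j) ^ 2 by rw [← pow_mul, mul_comm, pow_mul]; norm_num]
          exact Real.sqrt_sq (pow_nonneg (by norm_num) _)

/-- **Uniform row bound `W₁(j) ≤ W⁺(j)/ONE` for all `d ≥ D`, `1 ≤ j ≤ d`** (`D ≥ 9`). -/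
theorem W1r_le_wOf {D d : ℕ} (hD9 : 9 ≤ D) (hd : D ≤ d) {j : ℕ} (hj1 : 1 ≤ j) (hjd : j ≤ d) :
    W1r d j ≤ (wOf D j : ℝ) / ONE := by
  have hd3 : 3 ≤ d := by omega
  have hd0 : 0 < d := by omega
  have hD0 : 0 < D := by omega
  have hDR : (0 : ℝ) < D := by exact_mod_cast hD0
  have hdR : (0 : ℝ) < d := by exact_mod_cast hd0
  have hDd : (D : ℝ) ≤ d := by exact_mod_cast hd
  unfold wOf
  by_cases hj1' : j ≤ 1
  · have : j = 1 := by omega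
    subst this
    rw [if_pos le_rfl]
    unfold W1r rhoWinMin rhoHT
    simp
  rw [if_neg hj1']
  by_cases hj2 : j = 2
  · subst hj2; rw [if_pos rfl, (W1r_low_rows hd3).1, div_self ONE_facts.2.1]
  rw [if_neg hj2]
  by_cases hj3 : j = 3
  · subst hj3; rw [if_pos rfl]
    have hsq := (W1r_low_rows hd3).2.1
    have h0 := (W1r_nonneg hd3 (by norm_num : 1 ≤ 3)).1
    have hle : W1r d 3 ^ 2 ≤ 2 ^ 2 := by
      rw [hsq, div_le_iff₀ hdR]
      nlinarith
    push_cast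
    rw [mul_div_assoc, div_self ONE_facts.2.1, mul_one]
    nlinarith [h0, hle]
  rw [if_neg hj3]
  by_cases hj4 : j = 4
  · subst hj4; rw [if_pos rfl, (W1r_low_rows hd3).2.2 (by omega)]; push_cast; rw [mul_div_assoc, div_self ONE_facts.2.1, mul_one]
  rw [if_neg hj4]
  have hj5 : 5 ≤ j := by omega
  have hl : 0 < lam d ^ j := pow_pos ((lam_facts hd3).1) _
  by_cases h5 : j = 5
  · subst h5
    rw [if_pos rfl]
    unfold W1r rhoWinMin
    rw [if_neg (by omega : ¬ 5 ≤ 4), if_pos ⟨rfl, by omega⟩]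
    have hDf : 0 ≤ (d.descFactorial 5 : ℝ) := Nat.cast_nonneg _
    calc (d.descFactorial 5 : ℝ) * min (rhoHT d 5) (bndRow5 d / (2 * (d : ℝ)) ^ (((5:ℕ) : ℝ) / 2)) / lam d ^ 5
        ≤ (d.descFactorial 5 : ℝ) * (bndRow5 d / (2 * (d : ℝ)) ^ (((5:ℕ) : ℝ) / 2)) / lam d ^ 5 :=
          div_le_div_of_nonneg_right (mul_le_mul_of_nonneg_left (min_le_right _ _) hDf) hl.le
      _ = (4 * (d : ℝ) + 10) / d := boundRow5_eq (by omega)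
      _ ≤ (4 * (D : ℝ) + 10) / D := by
          rw [div_le_div_iff₀ hdR hDR]; nlinarith
      _ ≤ _ := by
          have := ofRatU_ge (4 * D + 10) D hD0
          push_cast at this
          exact this
  rw [if_neg h5]
  by_cases h6 : j = 6
  · subst h6
    rw [if_pos rfl]
    unfold W1r rhoWinMin
    rw [if_neg (by omega : ¬ 6 ≤ 4), if_neg (by omega : ¬ (6 = 5 ∧ 8 ≤ d)), if_pos ⟨rfl, by omega⟩]
    have hDf : 0 ≤ (d.descFactorial 6 : ℝ) := Nat.cast_nonneg _
    have hd2 : (0 : ℝ) < (d : ℝ) ^ 2 := by positivity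
    have hD2 : (0 : ℝ) < (D : ℝ) ^ 2 := by positivity
    calc (d.descFactorial 6 : ℝ) * min (rhoHT d 6) (bndRow6 d / (2 * (d : ℝ)) ^ (((6:ℕ) : ℝ) / 2)) / lam d ^ 6
        ≤ (d.descFactorial 6 : ℝ) * (bndRow6 d / (2 * (d : ℝ)) ^ (((6:ℕ) : ℝ) / 2)) / lam d ^ 6 :=
          div_le_div_of_nonneg_right (mul_le_mul_of_nonneg_left (min_le_right _ _) hDf) hl.le
      _ = (5 * (d : ℝ) ^ 2 + 30 * d + 8) / (d : ℝ) ^ 2 := boundRow6_eq (by omega)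
      _ ≤ (5 * (D : ℝ) ^ 2 + 30 * D + 8) / (D : ℝ) ^ 2 := by
          rw [div_le_div_iff₀ hd2 hD2]
          nlinarith [mul_nonneg (sub_nonneg.mpr hDd) (by positivity : (0:ℝ) ≤ (d : ℝ) * D),
            mul_nonneg (sub_nonneg.mpr hDd) (by positivity : (0:ℝ) ≤ (d : ℝ) + D)]
      _ ≤ _ := by
          have := ofRatU_ge (5 * D ^ 2 + 30 * D + 8) (D ^ 2) (by positivity)
          push_cast at this
          exact this
  rw [if_neg h6]
  have hj7 : 7 ≤ j := by omega
  have hwin : (6 / 5 * ((j : ℝ) - 1) * Pr d j) ≤ (cdiv (6 * (j - 1) * ONE) 5 : ℝ) / ONE := by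
    have hc := div_le_cdiv (6 * (j - 1) * ONE) 5 (by norm_num)
    rw [le_div_iff₀ ONE_facts.1]
    refine le_trans ?_ hc
    have hP := (Pr_facts hd0 j).2
    have hP0 := (Pr_facts hd0 j).1
    have hjR : (0 : ℝ) ≤ (j : ℝ) - 1 := by
      have : (1 : ℝ) ≤ j := by exact_mod_cast hj1
      linarith
    push_cast [Nat.cast_sub hj1]
    rw [le_div_iff₀ (by norm_num : (0:ℝ) < 5)]
    nlinarith [ONE_facts.1, mul_nonneg hjR (sub_nonneg.mpr hP)]
  unfold W1r rhoWinMin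
  rw [if_neg (by omega : ¬ j ≤ 4), if_neg (by omega : ¬ (j = 5 ∧ 8 ≤ d)), if_neg (by omega : ¬ (j = 6 ∧ 9 ≤ d))]
  by_cases hwD : 4 * (j - 2) ^ 3 ≤ D
  · rw [if_pos hwD, if_pos (hwD.trans hd), window_eq d j hd3]
    exact hwin
  rw [if_neg hwD, Nat.cast_max, ← max_div_div_right ONE_facts.1.le]
  by_cases hw : 4 * (j - 2) ^ 3 ≤ d
  · rw [if_pos hw, window_eq d j hd3]
    exact hwin.trans (le_max_left _ _)
  · rw [if_neg hw, energy_eq hd3 (by omega) hjd]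
    refine le_trans ?_ (le_max_right _ _)
    have hP := (Pr_facts hd0 j).2
    have hP0 := (Pr_facts hd0 j).1
    have hdlt : (d : ℝ) ≤ ((4 * (j - 2) ^ 3 : ℕ) : ℝ) := by exact_mod_cast (show d ≤ 4 * (j - 2) ^ 3 by omega)
    have hdP : (d : ℝ) * Pr d j ≤ ((4 * (j - 2) ^ 3 : ℕ) : ℝ) := by nlinarith [Nat.cast_nonneg (α := ℝ) d]
    calc √((d : ℝ) * Pr d j) ≤ √(((4 * (j - 2) ^ 3 : ℕ) : ℝ)) := Real.sqrt_le_sqrt hdP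
      _ ≤ _ := by
          apply sqrtU_ge
          push_cast
          rw [mul_div_assoc, div_self ONE_facts.2.1, mul_one]

/-- `0 ≤ g ≤ 1` and the term identity of the second sum in the scaled frame
(`(d)_j e_j (2/B_d)^j = P_j g^j ẽ_j`; the identity is eng-2's `term2_eq`, restated here so that this part needs only parts ≤ 5). -/
theorem gr_facts_tail {d : ℕ} (hd : 3 ≤ d) :
    (0 ≤ gr d ∧ gr d ≤ 1) ∧ ∀ j : ℕ, (d.descFactorial j : ℝ) * cumulantCoeff (capFun d) j * (2 / hermiteTestBound d) ^ j
      = Pr d j * gr d ^ j * et d j := by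
  have hB : 0 < hermiteTestBound d := by unfold hermiteTestBound; positivity
  have hl := (lam_facts hd).1
  have hd0 : (d : ℝ) ≠ 0 := by
    have : (3 : ℝ) ≤ d := by exact_mod_cast hd
    linarith
  refine ⟨⟨?_, ?_⟩, ?_⟩
  · unfold gr
    exact div_nonneg (by positivity) (mul_nonneg hB.le hl.le)
  · unfold gr
    rw [div_le_one (mul_pos hB hl)]
    unfold hermiteTestBound
    have h1 : √(2 * (d : ℝ)) ≤ √(2 * (d : ℝ) + 1) := Real.sqrt_le_sqrt (by linarith)
    have h2 := sqrt_two_d_mul_lam d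
    nlinarith [mul_le_mul_of_nonneg_right h1 hl.le, hl.le]
  · intro j
    unfold Pr gr et
    rw [div_pow, div_pow, mul_pow, mul_pow]
    field_simp

/-! ## Assembly -/

/-- Geometric tails: `Σ_{i ∈ Ico J n} r^{i+1} ≤ r^{J+1}/(1−r)` for `0 ≤ r < 1`. -/
theorem sum_Ico_pow_succ_le {r : ℝ} (h0 : 0 ≤ r) (h1 : r < 1) (J n : ℕ) :
    ∑ i ∈ Ico J n, r ^ (i + 1) ≤ r ^ (J + 1) / (1 - r) := by
  rcases Nat.lt_or_ge n J with h | h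
  · rw [Finset.Ico_eq_empty (by omega), Finset.sum_empty]
    exact div_nonneg (pow_nonneg h0 _) (by linarith)
  · have : ∑ i ∈ Ico J n, r ^ (i + 1) = r * ∑ i ∈ Ico J n, r ^ i := by
      rw [Finset.mul_sum]
      apply Finset.sum_congr rfl; intro k _; ring
    rw [this, pow_succ', mul_div_assoc]
    exact mul_le_mul_of_nonneg_left (geom_sum_Ico_le_of_lt_one h0 h1) h0

/-- Fixed-point form of `C/ONE · 1/m ≤ ⌈C/m⌉/ONE`. -/
theorem fp_mul_inv_le (C m : ℕ) (hm : 0 < m) : (C : ℝ) / ONE * (1 / (m : ℝ)) ≤ (cdiv C m : ℝ) / ONE := by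
  rw [mul_one_div, div_right_comm]
  exact div_le_div_of_nonneg_right (div_le_cdiv C m hm) ONE_facts.1.le

/-- **Generic soundness of the uniform tail scheme.**  Data: threshold `D ≥ 9`, list `bts` dominating `b̃` below `KK`
at `d ≥ D`, `k`-tail `T`, table `etTab bts T J` (`7 ≤ J ≤ D`); checks `B + T ≤ 3·ONE`, the `4^k`-weighted `b̃`-sums
`≤ J + 1`, `S₁-head + ⌈C/2^J⌉ < ONE`, `S₂-head + ⌈C/(3·4^J)⌉ < ONE`.  Conclusion: both majorant sums `< 1` at `d`
(pin `10⁴`; scaled-frame identities `term1_eq` of part 5 and `gr_facts_tail`). -/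
theorem tail_sound_of {D d : ℕ} (bts : List ℕ) (T J : ℕ) (hD9 : 9 ≤ D) (hJ7 : 7 ≤ J) (hJD : J ≤ D) (hd : D ≤ d)
    (hbt : ∀ i, 2 ≤ i → i < KK → bt d (i + 1) ≤ (bts.getD (i - 2) 0 : ℝ) / ONE)
    (htail : ∀ n, ∑ i ∈ range n, (if KK ≤ i then bt d (i + 1) else 0) ≤ (T : ℝ) / ONE)
    (hGs : ∀ n, ∑ i ∈ range n, (if 2 ≤ i then bt d (i + 1) * 4 ^ (i + 1) else 0) ≤ (J : ℝ) + 1)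
    (hB : BKof bts + T ≤ 3 * ONE)
    (hS1 : S1Of (etTab bts T J) D J + cdiv (COf (etTab bts T J) J) (2 ^ J) < ONE)
    (hS2 : S2Of (etTab bts T J) J + cdiv (COf (etTab bts T J) J) (3 * 4 ^ J) < ONE) :
    (∑ j ∈ range d, (d.descFactorial (j + 1) : ℝ) * cumulantCoeff (capFun d) (j + 1) * rhoWinMin d (j + 1) < 1) ∧
    (∑ j ∈ range d, (d.descFactorial (j + 1) : ℝ) * cumulantCoeff (capFun d) (j + 1) *
      (2 / hermiteTestBound d) ^ (j + 1) < 1) := by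
  have hd3 : 3 ≤ d := by omega
  have hd9 : 9 ≤ d := by omega
  have hd0 : 0 < d := by omega
  have hJd : J ≤ d := hJD.trans hd
  set ets := etTab bts T J with hets
  set C := COf ets J with hCdef
  rw [Finset.sum_congr rfl (fun j _ => term1_eq hd3 (j + 1)),
    Finset.sum_congr rfl (fun j _ => (gr_facts_tail hd3).2 (j + 1))]
  -- the table bound and the geometric envelope
  have hle1 : ∀ j, et d j ≤ 1 := et_le_one d (sumB_le_three_of (sumBK_le_of bts hbt) htail hB)
  have hetU : ∀ j, et d j ≤ (etU bts T j : ℝ) / ONE := et_le_etU_of d bts T hle1 htail hbt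
  have hCb : ∀ j, j ≤ J → etU bts T j * 4 ^ j ≤ C := by
    intro j hj
    have := le_COf ets J hj
    rwa [hets, etTab_getD_rev bts T J hj] at this
  have hgeom : ∀ j, et d j ≤ (C : ℝ) / ONE * (1 / 4) ^ j := et_le_geom_of bts T C J (by omega) hetU hCb hGs
  have hC0 : 0 ≤ (C : ℝ) / ONE := fp_nonneg C
  have hsplit1 := (Finset.sum_range_add_sum_Ico (fun j => W1r d (j + 1) * et d (j + 1)) hJd).symm
  have hsplit2 := (Finset.sum_range_add_sum_Ico (fun j => Pr d (j + 1) * gr d ^ (j + 1) * et d (j + 1)) hJd).symm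
  constructor
  · rw [hsplit1]
    have hhead : ∑ j ∈ range J, W1r d (j + 1) * et d (j + 1) ≤ (S1Of ets D J : ℝ) / ONE := by
      unfold S1Of
      rw [Nat.cast_sum, Finset.sum_div]
      apply Finset.sum_le_sum
      intro j hj
      rw [Finset.mem_range] at hj
      have hw := W1r_le_wOf hD9 hd (by omega : 1 ≤ j + 1) (by omega)
      have he := hetU (j + 1)
      rw [← etTab_getD_rev bts T J (by omega : j + 1 ≤ J)] at he
      exact mulU_ge (W1r_nonneg hd3 (by omega : 1 ≤ j + 1)).1 (et_nonneg d _).1 hw he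
    have htail1 : ∑ j ∈ Ico J d, W1r d (j + 1) * et d (j + 1) ≤ (C : ℝ) / ONE * (1 / ((2 ^ J : ℕ) : ℝ)) := by
      have hterm : ∀ j ∈ Ico J d, W1r d (j + 1) * et d (j + 1) ≤ (C : ℝ) / ONE * (1 / 2) ^ (j + 1) := by
        intro j hj
        rw [Finset.mem_Ico] at hj
        have hw := W1r_le_two_pow hd9 (by omega : 7 ≤ j + 1) (by omega)
        have he := hgeom (j + 1)
        calc W1r d (j + 1) * et d (j + 1) ≤ (2 : ℝ) ^ (j + 1) * ((C : ℝ) / ONE * (1 / 4) ^ (j + 1)) :=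
              mul_le_mul hw he ((et_nonneg d _).1) (pow_nonneg (by norm_num) _)
          _ = (C : ℝ) / ONE * ((2 : ℝ) ^ (j + 1) * (1 / 4) ^ (j + 1)) := by ring
          _ = (C : ℝ) / ONE * (1 / 2) ^ (j + 1) := by rw [← mul_pow]; norm_num
      refine (Finset.sum_le_sum hterm).trans ?_
      rw [← Finset.mul_sum]
      apply mul_le_mul_of_nonneg_left _ hC0
      have := sum_Ico_pow_succ_le (by norm_num : (0:ℝ) ≤ 1 / 2) (by norm_num) J d
      refine this.trans (le_of_eq ?_)
      push_cast
      rw [pow_succ, one_div_pow]; field_simp; ring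
    have htail' : (C : ℝ) / ONE * (1 / ((2 ^ J : ℕ) : ℝ)) ≤ (cdiv C (2 ^ J) : ℝ) / ONE :=
      fp_mul_inv_le C (2 ^ J) (pow_pos (by norm_num) _)
    have hfin : ((S1Of ets D J : ℝ) + (cdiv C (2 ^ J) : ℝ)) / ONE < 1 := by
      rw [div_lt_one ONE_facts.1]; exact_mod_cast hS1
    rw [add_div] at hfin
    linarith
  · rw [hsplit2]
    have hterm0 : ∀ j, Pr d (j + 1) * gr d ^ (j + 1) * et d (j + 1) ≤ et d (j + 1) := by
      intro j
      have hP := (Pr_facts hd0 (j + 1)).2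
      have hP0 := (Pr_facts hd0 (j + 1)).1
      have hg1 : gr d ^ (j + 1) ≤ 1 := pow_le_one₀ (gr_facts_tail hd3).1.1 (gr_facts_tail hd3).1.2
      have hg0 : 0 ≤ gr d ^ (j + 1) := pow_nonneg (gr_facts_tail hd3).1.1 _
      have he0 := (et_nonneg d (j + 1)).1
      calc Pr d (j + 1) * gr d ^ (j + 1) * et d (j + 1) ≤ 1 * 1 * et d (j + 1) := by
            apply mul_le_mul_of_nonneg_right _ he0
            exact mul_le_mul hP hg1 hg0 zero_le_one
        _ = et d (j + 1) := by ring
    have hhead : ∑ j ∈ range J, Pr d (j + 1) * gr d ^ (j + 1) * et d (j + 1) ≤ (S2Of ets J : ℝ) / ONE := by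
      unfold S2Of
      rw [Nat.cast_sum, Finset.sum_div]
      apply Finset.sum_le_sum
      intro j hj
      rw [Finset.mem_range] at hj
      have he := hetU (j + 1)
      rw [← etTab_getD_rev bts T J (by omega : j + 1 ≤ J)] at he
      exact (hterm0 j).trans he
    have htail2 : ∑ j ∈ Ico J d, Pr d (j + 1) * gr d ^ (j + 1) * et d (j + 1)
        ≤ (C : ℝ) / ONE * (1 / ((3 * 4 ^ J : ℕ) : ℝ)) := by
      have hterm : ∀ j ∈ Ico J d, Pr d (j + 1) * gr d ^ (j + 1) * et d (j + 1) ≤ (C : ℝ) / ONE * (1 / 4) ^ (j + 1) :=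
        fun j _ => (hterm0 j).trans (hgeom (j + 1))
      refine (Finset.sum_le_sum hterm).trans ?_
      rw [← Finset.mul_sum]
      apply mul_le_mul_of_nonneg_left _ hC0
      have := sum_Ico_pow_succ_le (by norm_num : (0:ℝ) ≤ 1 / 4) (by norm_num) J d
      refine this.trans (le_of_eq ?_)
      push_cast
      rw [pow_succ, one_div_pow]; field_simp; ring
    have htail' : (C : ℝ) / ONE * (1 / ((3 * 4 ^ J : ℕ) : ℝ)) ≤ (cdiv C (3 * 4 ^ J) : ℝ) / ONE :=
      fp_mul_inv_le C (3 * 4 ^ J) (Nat.mul_pos (by norm_num) (pow_pos (by norm_num) _))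
    have hfin : ((S2Of ets J : ℝ) + (cdiv C (3 * 4 ^ J) : ℝ)) / ONE < 1 := by
      rw [div_lt_one ONE_facts.1]; exact_mod_cast hS2
    rw [add_div] at hfin
    linarith

/-- **Soundness of the uniform tail check: `tailCheck = true` ⇒ both majorant sums of item 19217 (pin `10⁴`, cap sequence
verbatim) are `< 1` for EVERY `d ≥ Dstar`.** -/
theorem tailCheck_sound (h : tailCheck = true) (d : ℕ) (hd : Dstar ≤ d) :
    (∑ j ∈ Finset.range d, (d.descFactorial (j + 1) : ℝ) *
        cumulantCoeff (fun k : ℕ => (if k ≤ 3 then (9 / 8 : ℝ) else (k : ℝ) * 4 ^ (k - 3) / 3) *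
          (Nat.factorial (k - 1) : ℝ) * (2 : ℝ) ^ ((k : ℝ) / 2) /
            ((max 10000 (2 * d ^ 3) + d : ℕ) : ℝ) ^ (((k : ℝ) - 2) / 2)) (j + 1) * rhoWinMin d (j + 1) < 1) ∧
    (∑ j ∈ Finset.range d, (d.descFactorial (j + 1) : ℝ) *
        cumulantCoeff (fun k : ℕ => (if k ≤ 3 then (9 / 8 : ℝ) else (k : ℝ) * 4 ^ (k - 3) / 3) *
          (Nat.factorial (k - 1) : ℝ) * (2 : ℝ) ^ ((k : ℝ) / 2) /
            ((max 10000 (2 * d ^ 3) + d : ℕ) : ℝ) ^ (((k : ℝ) - 2) / 2)) (j + 1) *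
          (2 / hermiteTestBound d) ^ (j + 1) < 1) := by
  unfold tailCheck at h
  simp only [Bool.and_eq_true, decide_eq_true_eq] at h
  obtain ⟨⟨⟨⟨⟨hyp, hzp⟩, hB⟩, hG⟩, hS1⟩, hS2⟩ := h
  have hD9 : 9 ≤ Dstar := by decide
  have hJ7 : 7 ≤ Jt := by decide
  have hJD : Jt ≤ Dstar := by decide
  have hD0 : 0 < Dstar := by omega
  have hy : √8 / (Dstar : ℝ) ≤ (yT : ℝ) / ONE := sqrt8_div_le Dstar hD0
  have hbt : ∀ i, 2 ≤ i → i < KK → bt d (i + 1) ≤ (btsT.getD (i - 2) 0 : ℝ) / ONE :=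
    fun i hi hiK => bt_le_btsOf sqrt_half_le hD0 hy hd hi hiK
  have htail : ∀ n, ∑ i ∈ range n, (if KK ≤ i then bt d (i + 1) else 0) ≤ (TT : ℝ) / ONE :=
    fun n => sumTail_le_TOf hD0 hy hd hyp n
  have hGr : (GOf btsT Dstar yT : ℝ) / ONE ≤ (Jt : ℝ) + 1 := by
    rw [div_le_iff₀ ONE_facts.1]; exact_mod_cast hG
  have hGs : ∀ n, ∑ i ∈ range n, (if 2 ≤ i then bt d (i + 1) * 4 ^ (i + 1) else 0) ≤ (Jt : ℝ) + 1 :=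
    fun n => (sumG_le_of btsT hD0 hy hd hbt hzp n).trans hGr
  exact tail_sound_of btsT TT Jt hD9 hJ7 hJD hd hbt htail hGs hB hS1 hS2

end

end Summit.RiemannHypothesis.RiemannHypothesis.Theorems.JensenPolynomials.CapCert
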